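import Literature.Claims.NS.AbuGhuwaleh2026b

/-!
# C61b `AbuGhuwaleh2026b` — kernel DISCHARGE of Step 1, Theorem 4.2 (23) p.10

`step1_Thm42_23_holds : Literature.Claims.NS.AbuGhuwaleh2026b.Step1_Thm42_23` — the pointwise
bound (23) is TRUE (no small divisor: `Ω₁(k,p) ≥ ν|k|² ≥ νR²` by (15)). With `p·α = 0` one has
`ξ·α = k·α` and `ζ·α = k·α − p′·α`, so the difference is
`(k·α)(Ω₁(k,p′) − Ω₁(k,p))/(Ω₁Ω₁′) + (p′·α)/Ω₁(k,p′)`, and `|Ω₁(k,p) − Ω₁(k,p′)| ≤ 12 ν R·R^{3/4}`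
(the p.10 sentence «= ν||p|² − |p′|²|» forgets `|k−p|² − |k−p′|²`, but the bound survives), whence
`|…| ≤ (25/ν) R^{−5/4} ‖α‖`. Companion of the kill file `SoloRefuteAbuGhuwaleh2026b.lean`
(`not_Step2_Thm42_2425`, p495906): Step 1 discharged, Step 2 refuted — the first failing step of
the typed chain is Step 2 in the kernel. [cite: AbuGhuwaleh2026b, Thm 4.2 (23) p.10; (15) p.7]

WHAT THIS IS NOT: not a claim about NS regularity or blow-up; not a claim about any author beyond
the typed locator.
-/

set_option linter.dupNamespace false

open Finset Literature.Analysis.FunctionSpaces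

namespace Summit.NavierStokesRegularity.NavierStokesRegularity.Theorems.AbuGhuwaleh2026b

open Literature.Claims.NS.AbuGhuwaleh2026b

/-- `(ξ − η)·α = ξ·α − η·α`. -/
theorem dotZ_sub (ξ η : Z3) (α : E3) : dotZ (ξ - η) α = dotZ ξ α - dotZ η α := by
  simp only [dotZ, Pi.sub_apply, Int.cast_sub, sub_mul, Finset.sum_sub_distrib]

/-- `|k − p|² = |k|² − 2 k·p + |p|²` (the integer dot product written as a real sum). -/
theorem freqNormSq_sub (k p : Z3) :
    Torus.freqNormSq (k - p) =
      Torus.freqNormSq k - 2 * (∑ i, (k i : ℝ) * (p i : ℝ)) + Torus.freqNormSq p := by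
  simp only [Torus.freqNormSq, Pi.sub_apply, Int.cast_sub, Finset.mul_sum,
    ← Finset.sum_add_distrib, ← Finset.sum_sub_distrib]
  refine Finset.sum_congr rfl fun i _ => ?_
  ring

/-- `lnorm ξ ≥ 0`. -/
theorem lnorm_nonneg (ξ : Z3) : 0 ≤ lnorm ξ := Real.sqrt_nonneg _

/-- `(lnorm ξ)² = |ξ|²`. -/
theorem lnorm_sq (ξ : Z3) : lnorm ξ ^ 2 = Torus.freqNormSq ξ := by
  unfold lnorm
  exact Real.sq_sqrt (Torus.freqNormSq_nonneg ξ)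

/-- Cauchy–Schwarz: `|ξ·α| ≤ |ξ| ‖α‖`. -/
theorem abs_dotZ_le (ξ : Z3) (α : E3) : |dotZ ξ α| ≤ lnorm ξ * ‖α‖ := by
  have hcs :=
    Finset.sum_mul_sq_le_sq_mul_sq Finset.univ (fun i => (ξ i : ℝ)) (fun i => α i)
  have hα : ‖α‖ ^ 2 = ∑ i, α i ^ 2 := by
    rw [EuclideanSpace.norm_eq, Real.sq_sqrt (Finset.sum_nonneg fun i _ => by positivity)]
    simp [Real.norm_eq_abs, sq_abs]
  have h2 : (dotZ ξ α) ^ 2 ≤ (lnorm ξ * ‖α‖) ^ 2 := by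
    rw [mul_pow, lnorm_sq, hα]
    unfold dotZ Torus.freqNormSq
    exact hcs
  exact abs_le_of_sq_le_sq h2 (mul_nonneg (lnorm_nonneg ξ) (norm_nonneg α))

/-- Cauchy–Schwarz: `|k·p| ≤ |k| |p|`. -/
theorem abs_dotZZ_le (k p : Z3) : |∑ i, (k i : ℝ) * (p i : ℝ)| ≤ lnorm k * lnorm p := by
  have hcs :=
    Finset.sum_mul_sq_le_sq_mul_sq Finset.univ (fun i => (k i : ℝ)) (fun i => (p i : ℝ))
  have h2 : (∑ i, (k i : ℝ) * (p i : ℝ)) ^ 2 ≤ (lnorm k * lnorm p) ^ 2 := by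
    rw [mul_pow, lnorm_sq, lnorm_sq]
    unfold Torus.freqNormSq
    exact hcs
  exact abs_le_of_sq_le_sq h2 (mul_nonneg (lnorm_nonneg k) (lnorm_nonneg p))

/-- `Ω₁(k,p) ≥ ν|k|²`. -/
theorem Ω₁_ge (ν : ℝ) (hν : 0 < ν) (k p : Z3) : ν * lnorm k ^ 2 ≤ Ω₁ ν k p := by
  unfold Ω₁
  rw [lnorm_sq]
  have h1 := Torus.freqNormSq_nonneg p
  have h2 := Torus.freqNormSq_nonneg (k - p)
  nlinarith

/-- `Ω₁(k,p) − Ω₁(k,p′) = ν(2|p|² − 2|p′|² − 2k·p + 2k·p′)`. -/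
theorem Ω₁_sub (ν : ℝ) (k p p' : Z3) :
    Ω₁ ν k p - Ω₁ ν k p' = ν * (2 * Torus.freqNormSq p - 2 * Torus.freqNormSq p'
      - 2 * (∑ i, (k i : ℝ) * (p i : ℝ)) + 2 * (∑ i, (k i : ℝ) * (p' i : ℝ))) := by
  unfold Ω₁
  rw [freqNormSq_sub k p, freqNormSq_sub k p']
  ring

/-- `R^{−5/4} = R^{3/4}/R²` for `R > 0`. -/
theorem rpow_neg_five_quarters {R : ℝ} (hR : 0 < R) :
    R ^ (-(5 / 4 : ℝ)) = R ^ (3 / 4 : ℝ) / R ^ 2 := by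
  rw [show (-(5 / 4 : ℝ)) = (3 / 4 : ℝ) - 2 by norm_num, Real.rpow_sub hR, Real.rpow_two]

/-- `R^{3/4} ≤ R` for `R ≥ 1`. -/
theorem rpow_three_quarters_le {R : ℝ} (hR : 1 ≤ R) : R ^ (3 / 4 : ℝ) ≤ R := by
  calc R ^ (3 / 4 : ℝ) ≤ R ^ (1 : ℝ) := Real.rpow_le_rpow_of_exponent_le hR (by norm_num)
    _ = R := Real.rpow_one R

/-- **Step 1 — Theorem 4.2 (23) p.10 HOLDS** (kernel), with `C = 25/ν`.
[cite: AbuGhuwaleh2026b, Thm 4.2 (23) p.10; (15) p.7] -/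
theorem step1_Thm42_23_holds : Literature.Claims.NS.AbuGhuwaleh2026b.Step1_Thm42_23 := by
  intro ν cstar hν hc hc1
  refine ⟨25 / ν, ?_⟩
  intro R hR k p p' hkR hk2R hp hp' α hpα
  have hR0 : 0 < R := by linarith
  set Q : ℝ := R ^ (3 / 4 : ℝ) with hQ_def
  have hQ0 : 0 ≤ Q := by positivity
  have hQR : Q ≤ R := rpow_three_quarters_le hR
  have hP : lnorm p ≤ Q := hp.trans (by nlinarith [mul_le_of_le_one_left hQ0 hc1])
  have hP' : lnorm p' ≤ Q := hp'.trans (by nlinarith [mul_le_of_le_one_left hQ0 hc1])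
  have hK0 : 0 ≤ lnorm k := lnorm_nonneg k
  -- the two denominators
  set O : ℝ := Ω₁ ν k p with hO_def
  set O' : ℝ := Ω₁ ν k p' with hO'_def
  have hR2 : ν * R ^ 2 ≤ ν * lnorm k ^ 2 := by
    have : R ^ 2 ≤ lnorm k ^ 2 := pow_le_pow_left₀ hR0.le hkR 2
    exact mul_le_mul_of_nonneg_left this hν.le
  have hO : ν * R ^ 2 ≤ O := hR2.trans (Ω₁_ge ν hν k p)
  have hO' : ν * R ^ 2 ≤ O' := hR2.trans (Ω₁_ge ν hν k p')
  have hνR2 : 0 < ν * R ^ 2 := by positivity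
  have hOpos : 0 < O := hνR2.trans_le hO
  have hO'pos : 0 < O' := hνR2.trans_le hO'
  -- numerators
  set X : ℝ := dotZ k α with hX_def
  set Y : ℝ := dotZ p' α with hY_def
  have hξ : dotZ (k - p) α = X := by rw [dotZ_sub, hpα, sub_zero]
  have hζ : dotZ (k - p - p') α = X - Y := by rw [dotZ_sub, hξ]
  have hX : |X| ≤ 2 * R * ‖α‖ :=
    (abs_dotZ_le k α).trans (mul_le_mul_of_nonneg_right hk2R (norm_nonneg α))
  have hY : |Y| ≤ Q * ‖α‖ :=
    (abs_dotZ_le p' α).trans (mul_le_mul_of_nonneg_right hP' (norm_nonneg α))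
  -- the difference of the denominators
  have hΔ : |O' - O| ≤ 12 * ν * R * Q := by
    have e := Ω₁_sub ν k p' p
    rw [← hO_def, ← hO'_def] at e
    rw [e, abs_mul, abs_of_pos hν]
    have h1 : Torus.freqNormSq p ≤ Q ^ 2 := by
      rw [← lnorm_sq]; exact pow_le_pow_left₀ (lnorm_nonneg p) hP 2
    have h2 : Torus.freqNormSq p' ≤ Q ^ 2 := by
      rw [← lnorm_sq]; exact pow_le_pow_left₀ (lnorm_nonneg p') hP' 2
    have h3 : |∑ i, (k i : ℝ) * (p i : ℝ)| ≤ 2 * R * Q :=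
      (abs_dotZZ_le k p).trans (mul_le_mul hk2R hP (lnorm_nonneg p) (by positivity))
    have h4 : |∑ i, (k i : ℝ) * (p' i : ℝ)| ≤ 2 * R * Q :=
      (abs_dotZZ_le k p').trans (mul_le_mul hk2R hP' (lnorm_nonneg p') (by positivity))
    have h5 : Q ^ 2 ≤ R * Q := by nlinarith
    have hp0 := Torus.freqNormSq_nonneg p
    have hp0' := Torus.freqNormSq_nonneg p'
    have hin : |2 * Torus.freqNormSq p' - 2 * Torus.freqNormSq p
        - 2 * (∑ i, (k i : ℝ) * (p' i : ℝ)) + 2 * (∑ i, (k i : ℝ) * (p i : ℝ))| ≤ 12 * R * Q := by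
      rw [abs_le] at h3 h4 ⊢
      constructor <;> nlinarith
    calc ν * |2 * Torus.freqNormSq p' - 2 * Torus.freqNormSq p
          - 2 * (∑ i, (k i : ℝ) * (p' i : ℝ)) + 2 * (∑ i, (k i : ℝ) * (p i : ℝ))|
        ≤ ν * (12 * R * Q) := mul_le_mul_of_nonneg_left hin hν.le
      _ = 12 * ν * R * Q := by ring
  -- rewrite the expression
  have hE : dotZ (k - p) α / O - dotZ (k - p - p') α / O' =
      X * (O' - O) / (O * O') + Y / O' := by
    rw [hξ, hζ]
    field_simp
    ring
  rw [hE]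
  -- bound each term
  have hT1 : |X * (O' - O) / (O * O')| ≤
      (2 * R * ‖α‖) * (12 * ν * R * Q) / ((ν * R ^ 2) * (ν * R ^ 2)) := by
    rw [abs_div, abs_mul, abs_of_pos (mul_pos hOpos hO'pos)]
    have hnum : |X| * |O' - O| ≤ (2 * R * ‖α‖) * (12 * ν * R * Q) :=
      mul_le_mul hX hΔ (abs_nonneg _) (by positivity)
    have hden : (ν * R ^ 2) * (ν * R ^ 2) ≤ O * O' := mul_le_mul hO hO' hνR2.le hOpos.le
    exact div_le_div₀ (by positivity) hnum (by positivity) hden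
  have hT2 : |Y / O'| ≤ (Q * ‖α‖) / (ν * R ^ 2) := by
    rw [abs_div, abs_of_pos hO'pos]
    exact div_le_div₀ (by positivity) hY hνR2 hO'
  calc |X * (O' - O) / (O * O') + Y / O'|
      ≤ |X * (O' - O) / (O * O')| + |Y / O'| := abs_add_le _ _
    _ ≤ (2 * R * ‖α‖) * (12 * ν * R * Q) / ((ν * R ^ 2) * (ν * R ^ 2))
          + (Q * ‖α‖) / (ν * R ^ 2) := add_le_add hT1 hT2
    _ = 25 / ν * (Q / R ^ 2) * ‖α‖ := by
        field_simp
        ring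
    _ = 25 / ν * R ^ (-(5 / 4 : ℝ)) * ‖α‖ := by rw [rpow_neg_five_quarters hR0]

end Summit.NavierStokesRegularity.NavierStokesRegularity.Theorems.AbuGhuwaleh2026b
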